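import Literature.Analysis.Complex.Bieberbach
import Literature.Analysis.Complex.ConformalRadius
import HarnessLib

/-!
# Koebe's one-quarter theorem, proved

Trunk support (complex analysis). Discharge of the named fact `Literature.Analysis.Complex.KoebeQuarter` of
`Literature/Analysis/Complex/ConformalRadius.lean` (Lawler (2005), Thm. 3.17: for `f` univalent
on the unit disc, `B(f(0), |f'(0)|/4) ⊆ f(𝔻)`), from Bieberbach's theorem `|a₂| ≤ 2`
(`Literature.Analysis.Complex.AreaThm.norm_deriv_deriv_le_four`, `Literature/Analysis/Complex/Bieberbach.lean`) by the
classical argument (Duren, *Univalent Functions* (1983), Thm. 2.3; Pommerenke (1992), Cor. 1.4):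
if `f ∈ S` omits `w`, then `G = w f/(w - f) ∈ S` with `G''(0) = f''(0) + 2/w`, so
`|2/w| ≤ |G''(0)| + |f''(0)| ≤ 8`, i.e. `|w| ≥ 1/4`.

## References

* P. L. Duren, *Univalent Functions*, Springer (1983), §2.2, Thm. 2.3 (Koebe one-quarter).
* Ch. Pommerenke, *Boundary Behaviour of Conformal Maps* (1992), Cor. 1.4.
* G. F. Lawler, *Conformally Invariant Processes in the Plane* (2005), Thm. 3.17.
-/

noncomputable section

open Set Filter Metric Topology Complex

namespace Literature.Analysis.Complex

namespace AreaThm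

variable {f : ℂ → ℂ}

/-- **Koebe's one-quarter theorem for `f ∈ S`**: if `f` is holomorphic and injective on the unit
disc with `f(0) = 0`, `f'(0) = 1`, then every `w` with `|w| < 1/4` is a value of `f`.
[cite: PommerenkeBBCM1992, Cor. 1.4] -/
theorem mem_image_of_norm_lt_quarter (hf : DifferentiableOn ℂ f (ball 0 1)) (hinj : InjOn f (ball 0 1))
    (hf0 : f 0 = 0) (hf1 : deriv f 0 = 1) {w : ℂ} (hw : ‖w‖ < 1 / 4) : w ∈ f '' ball 0 1 := by
  have h0 : (0 : ℂ) ∈ ball (0 : ℂ) 1 := mem_ball_self one_pos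
  by_contra hnot
  have hw0 : w ≠ 0 := by rintro rfl; exact hnot ⟨0, h0, hf0⟩
  have hne : ∀ z ∈ ball (0 : ℂ) 1, w - f z ≠ 0 := fun z hz h ↦ hnot ⟨z, hz, (sub_eq_zero.1 h).symm⟩
  -- `G = w f/(w - f) ∈ S`
  set G : ℂ → ℂ := fun z ↦ w * f z / (w - f z) with hG
  have hGd : DifferentiableOn ℂ G (ball 0 1) := (hf.const_mul w).div (hf.const_sub w) hne
  have hGinj : InjOn G (ball 0 1) := by
    intro z₁ h₁ z₂ h₂ heq
    refine hinj h₁ h₂ ?_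
    have h := heq
    simp only [hG] at h
    rw [div_eq_div_iff (hne z₁ h₁) (hne z₂ h₂)] at h
    have : w * w * (f z₁ - f z₂) = 0 := by linear_combination h
    simpa [hw0, sub_eq_zero] using this
  have hG0 : G 0 = 0 := by simp [hG, hf0]
  -- `G' = w² f'/(w - f)²` on the disc
  have hGderiv : ∀ z ∈ ball (0 : ℂ) 1, deriv G z = w ^ 2 * deriv f z / (w - f z) ^ 2 := by
    intro z hz
    have hfz : HasDerivAt f (deriv f z) z := (hf.differentiableAt (isOpen_ball.mem_nhds hz)).hasDerivAt
    have h : HasDerivAt G ((w * deriv f z * (w - f z) - w * f z * -deriv f z) / (w - f z) ^ 2) z :=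
      (hfz.const_mul w).div (hfz.const_sub w) (hne z hz)
    rw [h.deriv]
    field_simp [hne z hz]
    ring
  have hG1 : deriv G 0 = 1 := by
    rw [hGderiv 0 h0, hf0, hf1, sub_zero, mul_one, div_self (pow_ne_zero 2 hw0)]
  -- `G''(0) = f''(0) + 2/w`
  have hd' : DifferentiableOn ℂ (deriv f) (ball 0 1) := differentiableOn_deriv isOpen_ball hf
  have hG2 : deriv (deriv G) 0 = deriv (deriv f) 0 + 2 / w := by
    have hev : deriv G =ᶠ[𝓝 0] fun z ↦ w ^ 2 * deriv f z / (w - f z) ^ 2 :=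
      Filter.eventuallyEq_of_mem (isOpen_ball.mem_nhds h0) hGderiv
    rw [hev.deriv_eq]
    have hf' : HasDerivAt (deriv f) (deriv (deriv f) 0) 0 :=
      (hd'.differentiableAt (isOpen_ball.mem_nhds h0)).hasDerivAt
    have hf0' : HasDerivAt f (deriv f 0) 0 := (hf.differentiableAt (isOpen_ball.mem_nhds h0)).hasDerivAt
    have hden : HasDerivAt (fun z ↦ (w - f z) ^ 2) (↑2 * (w - f 0) ^ (2 - 1) * (-deriv f 0)) 0 :=
      (hf0'.const_sub w).pow 2
    have h : HasDerivAt (fun z ↦ w ^ 2 * deriv f z / (w - f z) ^ 2)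
        ((w ^ 2 * deriv (deriv f) 0 * (w - f 0) ^ 2 -
          w ^ 2 * deriv f 0 * (↑2 * (w - f 0) ^ (2 - 1) * -deriv f 0)) / ((w - f 0) ^ 2) ^ 2) 0 :=
      (hf'.const_mul (w ^ 2)).div hden (by simp [hf0, hw0])
    rw [h.deriv, hf0, hf1]
    simp only [sub_zero, Nat.add_one_sub_one, pow_one, mul_neg, mul_one]
    field_simp
    ring
  -- Bieberbach for `G` and for `f`
  have hBG := norm_deriv_deriv_le_four hGd hGinj hG0 hG1
  have hBf := norm_deriv_deriv_le_four hf hinj hf0 hf1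
  rw [hG2] at hBG
  have h2w : ‖(2 : ℂ) / w‖ ≤ 8 := by
    have := norm_sub_le_norm_sub_add_norm_sub (deriv (deriv f) 0 + 2 / w) 0 (deriv (deriv f) 0)
    have h1 : ‖(2 : ℂ) / w‖ = ‖(deriv (deriv f) 0 + 2 / w) - deriv (deriv f) 0‖ := by ring_nf
    rw [h1]
    calc ‖deriv (deriv f) 0 + 2 / w - deriv (deriv f) 0‖
        ≤ ‖deriv (deriv f) 0 + 2 / w‖ + ‖deriv (deriv f) 0‖ := norm_sub_le _ _
      _ ≤ 4 + 4 := add_le_add hBG hBf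
      _ = 8 := by norm_num
  rw [norm_div, RCLike.norm_ofNat, div_le_iff₀ (norm_pos_iff.2 hw0)] at h2w
  linarith

end AreaThm

/-- **`Literature.Analysis.Complex.KoebeQuarter` holds: Koebe's one-quarter theorem** (Lawler (2005), Thm. 3.17;
Bieberbach 1916): for `f` holomorphic and injective on the unit disc,
`B(f(0), |f'(0)|/4) ⊆ f(𝔻)`. Proof: normalise to `(f - f(0))/f'(0) ∈ S` and apply
`AreaThm.mem_image_of_norm_lt_quarter` (from Bieberbach's `|a₂| ≤ 2`).
[cite: Lawler2008, Thm. 3.17 (p. 62)] -/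
theorem koebeQuarter_holds : KoebeQuarter := by
  intro f hf hinj w hw
  have h0 : (0 : ℂ) ∈ ball (0 : ℂ) 1 := mem_ball_self one_pos
  have hc0 : deriv f 0 ≠ 0 := SCV.deriv_ne_zero_of_injOn hf isOpen_ball hinj h0
  set c := deriv f 0 with hc
  set F : ℂ → ℂ := fun z ↦ (f z - f 0) / c with hF
  have hFd : DifferentiableOn ℂ F (ball 0 1) := (hf.sub_const _).div_const c
  have hFinj : InjOn F (ball 0 1) := fun z₁ h₁ z₂ h₂ heq ↦ hinj h₁ h₂ (by
    have := heq
    simp only [hF] at this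
    rw [div_left_inj' hc0] at this
    exact sub_left_injective this)
  have hF0 : F 0 = 0 := by simp [hF]
  have hFderiv : ∀ z ∈ ball (0 : ℂ) 1, deriv F z = deriv f z / c := fun z hz ↦
    (((hf.differentiableAt (isOpen_ball.mem_nhds hz)).hasDerivAt.sub_const (f 0)).div_const c).deriv
  have hF1 : deriv F 0 = 1 := by rw [hFderiv 0 h0, hc, div_self hc0]
  -- the rescaled target point
  set w' : ℂ := (w - f 0) / c with hw'
  have hw'n : ‖w'‖ < 1 / 4 := by
    rw [hw', norm_div, div_lt_iff₀ (norm_pos_iff.2 hc0)]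
    rw [mem_ball, dist_eq_norm] at hw
    linarith
  obtain ⟨z, hz, hFz⟩ := AreaThm.mem_image_of_norm_lt_quarter hFd hFinj hF0 hF1 hw'n
  refine ⟨z, hz, ?_⟩
  have : (f z - f 0) / c = (w - f 0) / c := hFz
  rw [div_left_inj' hc0] at this
  linear_combination this

end Literature.Analysis.Complex
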